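import Literature.Geometry.Symplectic.NearSymplecticFlatBirthDesign
import Literature.Geometry.Symplectic.GromovR4StdModel
import Literature.Geometry.Symplectic.NearSymplecticModelChartsReduction
import HarnessLib

/-!
# The standard models of `relNearSymplecticTaubesTubes_exists`: every smooth `4`-manifold
# diffeomorphic to `S⁴`, punctured anywhere (non-vacuity; "SPC4 ⇒ the fact")

Topic `Literature/Geometry/Symplectic`; companion of `NearSymplecticPuncturedSphere.lean` (the named
fact `Literature.Geometry.Symplectic.relNearSymplecticTaubesTubes_exists`: on every punctured
homotopy `4`-sphere there is a smooth closed `2`-form, standard on a punctured chart-ball at the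
puncture, with two disjoint untwisted Taubes tubes, non-degenerate off the two core circles —
Gerig 2021 Thm. 1.6 + Perutz 2006 + Honda 2004 Thm. 5).  Everything here is PROVED; no named fact
is introduced.

## What is proved

The conclusion of the fact holds at `(M, p)` for EVERY smooth `4`-manifold `M` and point `p` such
that `M ∖ {p}` is diffeomorphic to `ℝ⁴` by a diffeomorphism in chart form at the puncture
(`exists_taubesTubes_of_chartFormDiffeo`), hence for every `M` diffeomorphic to `S⁴` and every
`p ∈ M` (`exists_taubesTubes_of_nonempty_diffeomorph_sphere`, through Palais' disc theorem in the
tree's proved chart form `palais_puncturedSphere_chartForm_holds`), in particular on the round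
sphere itself (`sphere_taubesTubes`); and the named fact follows from the smooth Poincaré
hypothesis "every homotopy `4`-sphere is diffeomorphic to `S⁴`"
(`relNearSymplecticTaubesTubes_exists_of_forall_diffeomorph_sphere`).  So the eleven clauses of
the fact are JOINTLY SATISFIABLE in every intended model (the fact is not vacuous and not refuted
by its models), and what the fact asserts beyond these models is exactly its content on homotopy
`4`-spheres not known to be standard — where the printed proof (Gerig 2021, Thm. 1.6: `L²` Hodge
theory on the cylindrical-end completion and Honda's genericity; Perutz 2006 / Luttinger surgery
of zero circles) is the only known road (census in the seat notes).

The construction is the one printed for `X* = S⁴ ∖ pt = ℝ⁴` (Gerig 2021, §1, Example after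
Thm. 1.6: "`(ℝ⁴, ω_std)` … a pair of untwisted zero-circles can be introduced by a local
modification", i.e. Perutz 2006, Prop. 1.5 / Rem. 1.9, the Luttinger–Simpson birth model):

1. the **flat birth pair** `flatNearSymplecticTaubesTubes_exists_holds`
   (`NearSymplecticFlatBirthDesign.lean`, PROVED: Calabi–Perutz pair): a `C^∞` closed `2`-form `sf₀`
   on `ℝ⁴`, equal to `ω₀` on `{R ≤ ‖y‖}`, with two flat Taubes tubes `Ψ₁, Ψ₂ : U_δ → {‖·‖ < R}`
   (`Ψᵢ* sf₀ = formT`) and non-degenerate off the two cores;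
2. read `sf₀` as a form on the manifold `ℝ⁴` (`modelMForm`; smooth and closed in the tree's
   chart calculus: `isSmoothForm_modelMForm`, `isClosedForm_modelMForm`) and pull it back along the
   chart-form diffeomorphism `Φ : M ∖ {p} ≃ₘ ℝ⁴`, `Φ = ι ∘ (e − e p)` on a punctured chart-ball
   (`MForm.pullback`; smooth and closed by the tree's proved pull-back calculus, Warner 2.22–2.23);
3. on the punctured chart-ball of radius `ε ≤ min(ε_Φ, R⁻¹)` the point `Φ x = ι(e x − e p)` has
   norm `‖e x − e p‖⁻¹ > R`, so `sf₀(Φ x) = ω₀` and `dΦ_x = Dι(e x − e p) ∘ De_x`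
   (`hasMFDerivAt_inversion_extChartAt_sub`), which is the clause `IsStandardOnBall p ε (Φ* sf₀)`
   verbatim; the tubes `Φ⁻¹ ∘ Ψᵢ` stay in `Φ⁻¹{‖·‖ < R}`, hence off that ball;
4. tubes, disjointness and non-degeneracy are transported along the diffeomorphism (chain rule,
   `dΦ ∘ dΦ⁻¹ = id`).

## References

* C. Gerig, *No homotopy 4-sphere invariants using ECH=SWF*, Algebr. Geom. Topol. 21 (2021),
  Thm. 1.6 and §1 [Gerig2021NoHomotopySphereInvariants].
* T. Perutz, *Zero-sets of near-symplectic forms*, J. Symplectic Geom. 4 (2006), Prop. 1.5,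
  Rem. 1.9 [Perutz2006].
* R. S. Palais, *Extending diffeomorphisms*, Proc. AMS 11 (1960), Thm. B [Palais1960].
* C. H. Taubes, *The structure of pseudo-holomorphic subvarieties for a degenerate almost complex
  structure and symplectic form on `S¹ × B³`*, Geom. Topol. 2 (1998), eq. (1.1), §1.c
  [Taubes1998S1B3].
-/

noncomputable section

open scoped Manifold ContDiff Topology
open TopologicalSpace Set Literature.Geometry.Kaehler

namespace Literature.Geometry.Symplectic

/-- Local notation for the model space `ℝ⁴ = EuclideanSpace ℝ (Fin 4)`. -/
local notation "E4" => EuclideanSpace ℝ (Fin 4)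

/-- The round 4-sphere `S⁴ ⊆ ℝ⁵` with Mathlib's smooth structure. -/
local notation "𝕊⁴" => (Metric.sphere (0 : EuclideanSpace ℝ (Fin 5)) 1)

/-! ### §1 A `2`-form on `ℝ⁴` given as a map, read as a form on the manifold `ℝ⁴` -/

section Model

/-- **A `2`-form on `ℝ⁴` given as a map `ℝ⁴ → (ℝ⁴ [⋀^Fin 2]→L[ℝ] ℝ)`, read as a form on the
manifold `ℝ⁴`** (model `𝓡 4`, tangent spaces `= ℝ⁴`): the identity coercion, named so that the
tree's chart calculus (`IsSmoothForm`, `mextDeriv`, `MForm.pullback`) applies to the forms of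
`flatNearSymplecticTaubesTubes_exists`. [folklore] -/
def modelMForm (sf : E4 → E4 [⋀^Fin 2]→L[ℝ] ℝ) : MForm (𝓡 4) E4 ℝ 2 := fun q => sf q

/-- `modelMForm sf` is `sf` pointwise (definitional). [folklore] -/
@[simp] theorem modelMForm_apply (sf : E4 → E4 [⋀^Fin 2]→L[ℝ] ℝ) (q : E4) (v : Fin 2 → E4) :
    modelMForm sf q v = sf q v := rfl

/-- In the identity chart of the model space the chart representative of `modelMForm sf` is `sf`.
[folklore] -/
theorem inChart_modelMForm (sf : E4 → E4 [⋀^Fin 2]→L[ℝ] ℝ) (x : E4) :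
    (modelMForm sf).inChart x = modelMForm sf := by
  funext y
  ext v
  simp [MForm.inChart_apply]
  rfl

/-- A `C^∞` form on `ℝ⁴` is a smooth form on the manifold `ℝ⁴`. [folklore] -/
theorem isSmoothForm_modelMForm {sf : E4 → E4 [⋀^Fin 2]→L[ℝ] ℝ} (h : ContDiff ℝ ∞ sf) :
    IsSmoothForm (modelMForm sf) := by
  intro x
  rw [inChart_modelMForm]
  exact h.contDiffAt.contDiffWithinAt

/-- A form on `ℝ⁴` with `extDeriv sf = 0` is closed on the manifold `ℝ⁴` (on the model space the
manifold exterior derivative is Mathlib's `extDeriv`, `mextDeriv_eq_extDeriv`). [folklore] -/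
theorem isClosedForm_modelMForm {sf : E4 → E4 [⋀^Fin 2]→L[ℝ] ℝ} (h : extDeriv sf = 0) :
    IsClosedForm (modelMForm sf) := by
  show mextDeriv (modelMForm sf) = 0
  funext x
  rw [mextDeriv_eq_extDeriv]
  exact congrFun h x

variable {EM : Type*} [NormedAddCommGroup EM] [NormedSpace ℝ EM] {HM : Type*}
  [TopologicalSpace HM] {I : ModelWithCorners ℝ EM HM}
  {N : Type*} [TopologicalSpace N] [ChartedSpace HM N]

/-- `(f* sf)_x(v, w) = sf(f x)(df_x v, df_x w)` (Warner (1983), 2.22). [cite: WarnerGTM94, 2.22] -/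
theorem modelMForm_pullback_apply (sf : E4 → E4 [⋀^Fin 2]→L[ℝ] ℝ) (f : N → E4) (x : N)
    (v w : TangentSpace I x) :
    (modelMForm sf).pullback I f x ![v, w] =
      sf (f x) ![mfderiv I (𝓡 4) f x v, mfderiv I (𝓡 4) f x w] := by
  rw [MForm.pullback_apply]
  have h : (fun i => mfderiv I (𝓡 4) f x (![v, w] i)) =
      ![mfderiv I (𝓡 4) f x v, mfderiv I (𝓡 4) f x w] := by
    funext i
    fin_cases i <;> rfl
  rw [h]
  rfl

variable [IsManifold I ∞ N]

/-- **`f* sf` is a smooth form** for `f : N → ℝ⁴` and `sf` of class `C^∞` (Warner (1983), 2.22,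
the tree's proved pull-back calculus). [cite: WarnerGTM94, 2.22] -/
theorem isSmoothForm_modelMForm_pullback {sf : E4 → E4 [⋀^Fin 2]→L[ℝ] ℝ} {f : N → E4}
    (hf : ContMDiff I (𝓡 4) ∞ f) (hs : ContDiff ℝ ∞ sf) :
    IsSmoothForm ((modelMForm sf).pullback I f) :=
  Literature.NumberTheory.Transcendental.isSmoothForm_pullback hf (isSmoothForm_modelMForm hs)

/-- **`f* sf` is closed** for `f` and `sf` of class `C^∞` with `extDeriv sf = 0`:
`d(f* sf) = f*(d sf) = 0` (Warner (1983), Prop. 2.23). [cite: WarnerGTM94, Prop. 2.23] -/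
theorem isClosedForm_modelMForm_pullback {sf : E4 → E4 [⋀^Fin 2]→L[ℝ] ℝ} {f : N → E4}
    (hf : ContMDiff I (𝓡 4) ∞ f) (hs : ContDiff ℝ ∞ sf) (hd : extDeriv sf = 0) :
    IsClosedForm ((modelMForm sf).pullback I f) := by
  show mextDeriv ((modelMForm sf).pullback I f) = 0
  rw [Literature.NumberTheory.Transcendental.mextDeriv_pullback hf (isSmoothForm_modelMForm hs)]
  have h0 : mextDeriv (modelMForm sf) = 0 := isClosedForm_modelMForm hd
  rw [h0, MForm.pullback_zero]

end Model

/-! ### §2 Transport along a diffeomorphism `M ∖ {p} ≃ₘ ℝ⁴` in chart form at the puncture -/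

section ChartForm

variable {M : Type*} [TopologicalSpace M] [T2Space M] [ChartedSpace (EuclideanSpace ℝ (Fin 4)) M]

/-- On the punctured manifold the recentred chart never vanishes: `e x − e p ≠ 0` for `x ≠ p` in
the chart source. [folklore] -/
private theorem recentredChart_ne_zero (p : M) (x : punctured p)
    (hx : x.1 ∈ (chartAt (EuclideanSpace ℝ (Fin 4)) p).source) :
    extChartAt (𝓡 4) p x.1 - extChartAt (𝓡 4) p p ≠ 0 := by
  intro h0
  have h1 : extChartAt (𝓡 4) p x.1 = extChartAt (𝓡 4) p p := sub_eq_zero.1 h0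
  have hsrc : (chartAt (EuclideanSpace ℝ (Fin 4)) p).source = (extChartAt (𝓡 4) p).source :=
    (extChartAt_source (I := 𝓡 4) p).symm
  have h2 : x.1 = p :=
    (extChartAt (𝓡 4) p).injOn (show x.1 ∈ (extChartAt (𝓡 4) p).source from hsrc ▸ hx)
      (mem_extChartAt_source (I := 𝓡 4) p) h1
  exact (mem_punctured.1 x.2) h2

/-- On the punctured chart-ball of radius `ε`, the inverted recentred chart has norm `> ε⁻¹`:
`‖ι(e x − e p)‖ = ‖e x − e p‖⁻¹` and `0 < ‖e x − e p‖ < ε`. [folklore] -/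
theorem inv_lt_norm_inversion_extChartAt_sub (p : M) {ε : ℝ} (x : punctured p)
    (hx : InPuncturedChartBall p ε x) :
    ε⁻¹ < ‖inversion (extChartAt (𝓡 4) p x.1 - extChartAt (𝓡 4) p p)‖ := by
  have hne := recentredChart_ne_zero p x hx.1
  have hpos : 0 < ‖extChartAt (𝓡 4) p x.1 - extChartAt (𝓡 4) p p‖ := norm_pos_iff.2 hne
  have hlt : ‖extChartAt (𝓡 4) p x.1 - extChartAt (𝓡 4) p p‖ < ε := by
    have := hx.2
    rwa [Metric.mem_ball, dist_eq_norm] at this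
  rw [norm_inversion]
  exact (inv_lt_inv₀ (lt_trans hpos hlt) hpos).2 hlt

variable [IsManifold (𝓡 4) ∞ M]

/-- **The conclusion of `relNearSymplecticTaubesTubes_exists` at `(M, p)` whenever `M ∖ {p}` is
diffeomorphic to `ℝ⁴` in chart form at `p`.**  Let `Φ : M ∖ {p} ≃ₘ ℝ⁴` agree with the inverted
recentred chart `ι ∘ (e − e p)` on some punctured chart-ball at `p`.  Then there are `ε > 0` with
`closedBall (e p) ε ⊆ e.target`, `0 < δ < 1`, a smooth closed `2`-form `sf` on `M ∖ {p}` standard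
on the punctured `ε`-chart-ball, two untwisted Taubes tubes of radius `δ` off that ball with
disjoint images, and `sf` is non-degenerate off the two core circles: namely `sf = Φ* sf₀` and
`Ψᵢ = Φ⁻¹ ∘ Ψᵢ⁰` for the flat birth pair `(sf₀, Ψ₁⁰, Ψ₂⁰)` of
`flatNearSymplecticTaubesTubes_exists_holds` (Gerig 2021, §1, the example `X = S⁴`:
"`(ℝ⁴, ω_std)` … a pair of untwisted zero-circles can be introduced"; Perutz 2006, Prop. 1.5 /
Rem. 1.9), with `ε ≤ min(ε_Φ, R⁻¹)`. [cite: Gerig2021NoHomotopySphereInvariants, §1 (after Thm. 1.6)]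
[cite: Perutz2006, Prop. 1.5, Rem. 1.9] -/
theorem exists_taubesTubes_of_chartFormDiffeo (p : M)
    (Φ : (punctured p) ≃ₘ⟮𝓡 4, 𝓡 4⟯ EuclideanSpace ℝ (Fin 4)) (hΦ : AgreesWithInvertedChartNear p Φ) :
    ∃ (ε δ : ℝ) (sf : MForm (𝓡 4) (punctured p) ℝ 2) (Ψ₁ Ψ₂ : E4 → punctured p),
      0 < ε ∧ Metric.closedBall (extChartAt (𝓡 4) p p) ε ⊆ (extChartAt (𝓡 4) p).target ∧
      0 < δ ∧ δ < 1 ∧ IsSmoothForm sf ∧ IsClosedForm sf ∧ IsStandardOnBall p ε sf ∧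
      IsUntwistedTaubesTube p ε δ sf Ψ₁ ∧ IsUntwistedTaubesTube p ε δ sf Ψ₂ ∧
      Disjoint (Ψ₁ '' flatSolidTorus δ) (Ψ₂ '' flatSolidTorus δ) ∧
      ∀ x : punctured p, x ∉ Ψ₁ '' flatCoreCircle ∪ Ψ₂ '' flatCoreCircle →
        ∀ v : TangentSpace (𝓡 4) x, v ≠ 0 → ∃ w : TangentSpace (𝓡 4) x, sf x ![v, w] ≠ 0 := by
  obtain ⟨R, δ, sf₀, Ψ₁, Ψ₂, hR, hδ, hδ1, hsm, hcl, hstd, hT₁, hT₂, hdisj, hnd⟩ :=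
    flatNearSymplecticTaubesTubes_exists_holds
  obtain ⟨ε₀, hε₀, hagree⟩ := hΦ
  -- a closed chart-ball inside the target of the extended chart
  obtain ⟨ε₁, hε₁, hball₁⟩ : ∃ ε₁ : ℝ, 0 < ε₁ ∧
      Metric.closedBall (extChartAt (𝓡 4) p p) ε₁ ⊆ (extChartAt (𝓡 4) p).target :=
    Metric.nhds_basis_closedBall.mem_iff.1 (extChartAt_target_mem_nhds (I := 𝓡 4) p)
  set ε : ℝ := min ε₀ (min ε₁ R⁻¹) with hε_def
  have hε : 0 < ε := lt_min hε₀ (lt_min hε₁ (inv_pos.2 hR))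
  have hεε₀ : ε ≤ ε₀ := min_le_left _ _
  have hεε₁ : ε ≤ ε₁ := (min_le_right _ _).trans (min_le_left _ _)
  have hεR : ε ≤ R⁻¹ := (min_le_right _ _).trans (min_le_right _ _)
  have hn : (∞ : WithTop ℕ∞) ≠ 0 := by simp
  -- smoothness of `Φ`, `Φ⁻¹` and of the flat tubes
  have hΦs : ContMDiff (𝓡 4) (𝓡 4) ∞ Φ := Φ.contMDiff
  have hΦis : ContMDiff (𝓡 4) (𝓡 4) ∞ Φ.symm := Φ.symm.contMDiff
  -- the form and the tubes
  set sf : MForm (𝓡 4) (punctured p) ℝ 2 := (modelMForm sf₀).pullback (𝓡 4) Φ with hsf_def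
  -- points of the punctured `ε`-ball are sent beyond radius `R`
  have hfar : ∀ x : punctured p, InPuncturedChartBall p ε x → R < ‖Φ x‖ := by
    intro x hx
    have hx₀ : InPuncturedChartBall p ε₀ x := hx.mono hεε₀
    rw [hagree x hx₀.1 hx₀.2]
    have h1 := inv_lt_norm_inversion_extChartAt_sub p x hx
    have h2 : R ≤ ε⁻¹ := by
      have := (inv_le_inv₀ (inv_pos.2 hR) hε).2 hεR
      rwa [inv_inv] at this
    exact lt_of_le_of_lt h2 h1
  -- the derivative of `Φ` on the punctured `ε`-ball
  have hDΦ : ∀ x : punctured p, InPuncturedChartBall p ε x → ∀ v : TangentSpace (𝓡 4) x,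
      mfderiv (𝓡 4) (𝓡 4) Φ x v =
        fderiv ℝ inversion (extChartAt (𝓡 4) p x.1 - extChartAt (𝓡 4) p p)
          (mfderiv (𝓡 4) 𝓘(ℝ, EuclideanSpace ℝ (Fin 4))
            (fun z : punctured p => extChartAt (𝓡 4) p z.1) x v) := by
    intro x hx v
    have hev : (⇑Φ : punctured p → EuclideanSpace ℝ (Fin 4)) =ᶠ[𝓝 x]
        fun z : punctured p => inversion (extChartAt (𝓡 4) p z.1 - extChartAt (𝓡 4) p p) :=
      Filter.eventuallyEq_of_mem ((isOpen_setOf_inPuncturedChartBall p ε).mem_nhds hx)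
        fun z hz => hagree z (InPuncturedChartBall.mono hεε₀ hz).1
          (InPuncturedChartBall.mono hεε₀ hz).2
    have hΦ' := (hasMFDerivAt_inversion_extChartAt_sub p x hx.1).congr_of_eventuallyEq hev
    rw [hΦ'.mfderiv]
    rfl
  -- transport of a flat tube
  have htube : ∀ Ψ : E4 → E4,
      (ContDiffOn ℝ ∞ Ψ (flatSolidTorus δ) ∧ Set.InjOn Ψ (flatSolidTorus δ) ∧
        (∀ y ∈ flatSolidTorus δ, Function.Injective (fderiv ℝ Ψ y)) ∧
        (∀ y ∈ flatSolidTorus δ, ‖Ψ y‖ < R) ∧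
        (∀ y ∈ flatSolidTorus δ, ∀ u v : E4,
          sf₀ (Ψ y) ![fderiv ℝ Ψ y u, fderiv ℝ Ψ y v] = untwistedTubeForm y u v)) →
      IsUntwistedTaubesTube p ε δ sf (fun y => Φ.symm (Ψ y)) := by
    rintro Ψ ⟨hΨs, hΨinj, hΨimm, hΨR, hΨpull⟩
    have hopen : IsOpen (flatSolidTorus δ) := by
      have hc : Continuous fun y : E4 =>
          (Real.sqrt (y 0 ^ 2 + y 1 ^ 2) - 1) ^ 2 + y 2 ^ 2 + y 3 ^ 2 := by fun_prop
      exact isOpen_lt hc continuous_const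
    -- differentiability of `Ψ` and of `Φ⁻¹ ∘ Ψ` at points of the tube
    have hΨat : ∀ y ∈ flatSolidTorus δ, ContMDiffAt 𝓘(ℝ, E4) (𝓡 4) ∞ Ψ y := fun y hy =>
      contMDiffAt_iff_contDiffAt.2 ((hΨs y hy).contDiffAt (hopen.mem_nhds hy))
    have hcomp : ∀ y ∈ flatSolidTorus δ,
        ContMDiffAt 𝓘(ℝ, E4) (𝓡 4) ∞ (fun y => Φ.symm (Ψ y)) y := fun y hy =>
      (hΦis (Ψ y)).comp y (hΨat y hy)
    have hmfΨ : ∀ y ∈ flatSolidTorus δ, ∀ u : E4,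
        mfderiv 𝓘(ℝ, E4) (𝓡 4) Ψ y u = fderiv ℝ Ψ y u := by
      intro y _ u
      rw [mfderiv_eq_fderiv]
      rfl
    -- chain rule: `d(Φ ∘ Φ⁻¹ ∘ Ψ) = dΦ ∘ d(Φ⁻¹ ∘ Ψ)` and `Φ ∘ Φ⁻¹ ∘ Ψ = Ψ`
    have hchain : ∀ y ∈ flatSolidTorus δ, ∀ u : E4,
        mfderiv (𝓡 4) (𝓡 4) Φ (Φ.symm (Ψ y))
            (mfderiv 𝓘(ℝ, E4) (𝓡 4) (fun y => Φ.symm (Ψ y)) y u) = fderiv ℝ Ψ y u := by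
      intro y hy u
      have hfe : (Ψ : E4 → E4) =ᶠ[𝓝 y] fun y => Φ (Φ.symm (Ψ y)) :=
        Filter.Eventually.of_forall fun y' => (Φ.apply_symm_apply (Ψ y')).symm
      have h1 : mfderiv 𝓘(ℝ, E4) (𝓡 4) Ψ y =
          (mfderiv (𝓡 4) (𝓡 4) Φ (Φ.symm (Ψ y))).comp
            (mfderiv 𝓘(ℝ, E4) (𝓡 4) (fun y => Φ.symm (Ψ y)) y) := by
        rw [hfe.mfderiv_eq]
        exact mfderiv_comp y ((hΦs _).mdifferentiableAt hn) ((hcomp y hy).mdifferentiableAt hn)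
      have h2 : mfderiv 𝓘(ℝ, E4) (𝓡 4) Ψ y u =
          mfderiv (𝓡 4) (𝓡 4) Φ (Φ.symm (Ψ y))
            (mfderiv 𝓘(ℝ, E4) (𝓡 4) (fun y => Φ.symm (Ψ y)) y u) :=
        DFunLike.congr_fun h1 u
      rw [hmfΨ y hy u] at h2
      exact h2.symm
    refine ⟨?_, ?_, ?_, ?_, ?_⟩
    · -- smooth on the tube
      intro y hy
      exact (hcomp y hy).contMDiffWithinAt
    · -- injective on the tube
      exact Φ.symm.injective.comp_injOn hΨinj
    · -- immersive on the tube
      intro y hy u₁ u₂ h12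
      have := congrArg (fun w => mfderiv (𝓡 4) (𝓡 4) Φ (Φ.symm (Ψ y)) w) h12
      simp only [hchain y hy] at this
      exact hΨimm y hy this
    · -- off the punctured `ε`-ball
      intro y hy hin
      have h1 := hfar _ hin
      rw [Φ.apply_symm_apply] at h1
      exact lt_asymm h1 (hΨR y hy)
    · -- `Ψ* sf = formT`
      intro y hy u v
      rw [hsf_def, modelMForm_pullback_apply]
      beta_reduce
      rw [hchain y hy u, hchain y hy v, Φ.apply_symm_apply]
      exact hΨpull y hy u v
  refine ⟨ε, δ, sf, fun y => Φ.symm (Ψ₁ y), fun y => Φ.symm (Ψ₂ y), hε,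
    (Metric.closedBall_subset_closedBall hεε₁).trans hball₁, hδ, hδ1,
    isSmoothForm_modelMForm_pullback hΦs hsm, isClosedForm_modelMForm_pullback hΦs hsm hcl,
    ?_, htube Ψ₁ hT₁, htube Ψ₂ hT₂, ?_, ?_⟩
  · -- standard on the punctured `ε`-ball
    intro x hx v w
    rw [hsf_def, modelMForm_pullback_apply, hstd (Φ x) (hfar x hx).le, hDΦ x hx v, hDΦ x hx w]
    rfl
  · -- disjoint tube images
    have h1 : (fun y => Φ.symm (Ψ₁ y)) '' flatSolidTorus δ = Φ.symm '' (Ψ₁ '' flatSolidTorus δ) :=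
      (image_image _ _ _).symm
    have h2 : (fun y => Φ.symm (Ψ₂ y)) '' flatSolidTorus δ = Φ.symm '' (Ψ₂ '' flatSolidTorus δ) :=
      (image_image _ _ _).symm
    rw [h1, h2]
    exact (Set.disjoint_image_iff Φ.symm.injective).2 hdisj
  · -- non-degenerate off the two core circles
    intro x hx v hv
    have hx' : Φ x ∉ Ψ₁ '' flatCoreCircle ∪ Ψ₂ '' flatCoreCircle := by
      rintro (⟨c, hc, hcx⟩ | ⟨c, hc, hcx⟩)
      · exact hx (Or.inl ⟨c, hc, by show Φ.symm (Ψ₁ c) = x; rw [hcx, Φ.symm_apply_apply]⟩)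
      · exact hx (Or.inr ⟨c, hc, by show Φ.symm (Ψ₂ c) = x; rw [hcx, Φ.symm_apply_apply]⟩)
    set L := Φ.mfderivToContinuousLinearEquiv hn x with hL_def
    have hL : ∀ u, L u = mfderiv (𝓡 4) (𝓡 4) Φ x u := fun u => rfl
    have hLv : L v ≠ 0 := fun h0 => hv (L.injective (h0.trans (map_zero L).symm))
    obtain ⟨b, hb⟩ := hnd (Φ x) hx' (L v) hLv
    refine ⟨L.symm b, ?_⟩
    rw [hsf_def, modelMForm_pullback_apply, ← hL, ← hL, L.apply_symm_apply]
    exact hb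

end ChartForm

/-! ### §3 The models: smooth `4`-manifolds diffeomorphic to `S⁴`, punctured anywhere -/

section SphereModels

variable {M : Type} [TopologicalSpace M] [T2Space M] [SecondCountableTopology M]
  [ChartedSpace (EuclideanSpace ℝ (Fin 4)) M] [IsManifold (𝓡 4) ∞ M]

/-- **A smooth `4`-manifold diffeomorphic to `S⁴` carries, on the complement of each point, the
data of `relNearSymplecticTaubesTubes_exists`** (through the chart-form diffeomorphism
`Φ : M ∖ {p} ≃ₘ ℝ⁴` of Palais' theorem, `palais_puncturedSphere_chartForm_holds`).  This is the
example `X = S⁴`, `X* = ℝ⁴` of Gerig 2021, §1, read through the atlas of `M`.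
[cite: Gerig2021NoHomotopySphereInvariants, §1 (after Thm. 1.6)] [cite: Palais1960, Thm. B] -/
theorem exists_taubesTubes_of_nonempty_diffeomorph_sphere
    (hM : Nonempty (M ≃ₘ⟮𝓡 4, 𝓡 4⟯ 𝕊⁴)) (p : M) :
    ∃ (ε δ : ℝ) (sf : MForm (𝓡 4) (punctured p) ℝ 2) (Ψ₁ Ψ₂ : E4 → punctured p),
      0 < ε ∧ Metric.closedBall (extChartAt (𝓡 4) p p) ε ⊆ (extChartAt (𝓡 4) p).target ∧
      0 < δ ∧ δ < 1 ∧ IsSmoothForm sf ∧ IsClosedForm sf ∧ IsStandardOnBall p ε sf ∧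
      IsUntwistedTaubesTube p ε δ sf Ψ₁ ∧ IsUntwistedTaubesTube p ε δ sf Ψ₂ ∧
      Disjoint (Ψ₁ '' flatSolidTorus δ) (Ψ₂ '' flatSolidTorus δ) ∧
      ∀ x : punctured p, x ∉ Ψ₁ '' flatCoreCircle ∪ Ψ₂ '' flatCoreCircle →
        ∀ v : TangentSpace (𝓡 4) x, v ≠ 0 → ∃ w : TangentSpace (𝓡 4) x, sf x ![v, w] ≠ 0 := by
  obtain ⟨Φ, hΦ⟩ := palais_puncturedSphere_chartForm_holds M p hM
  exact exists_taubesTubes_of_chartFormDiffeo p Φ hΦ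

/-- **The round sphere is a model**: for every `p ∈ S⁴` the conclusion of the fact holds on
`S⁴ ∖ {p}`. [cite: Gerig2021NoHomotopySphereInvariants, §1 (after Thm. 1.6)] -/
theorem sphere_taubesTubes (p : 𝕊⁴) :
    ∃ (ε δ : ℝ) (sf : MForm (𝓡 4) (punctured p) ℝ 2) (Ψ₁ Ψ₂ : E4 → punctured p),
      0 < ε ∧ Metric.closedBall (extChartAt (𝓡 4) p p) ε ⊆ (extChartAt (𝓡 4) p).target ∧
      0 < δ ∧ δ < 1 ∧ IsSmoothForm sf ∧ IsClosedForm sf ∧ IsStandardOnBall p ε sf ∧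
      IsUntwistedTaubesTube p ε δ sf Ψ₁ ∧ IsUntwistedTaubesTube p ε δ sf Ψ₂ ∧
      Disjoint (Ψ₁ '' flatSolidTorus δ) (Ψ₂ '' flatSolidTorus δ) ∧
      ∀ x : punctured p, x ∉ Ψ₁ '' flatCoreCircle ∪ Ψ₂ '' flatCoreCircle →
        ∀ v : TangentSpace (𝓡 4) x, v ≠ 0 → ∃ w : TangentSpace (𝓡 4) x, sf x ![v, w] ≠ 0 :=
  exists_taubesTubes_of_nonempty_diffeomorph_sphere ⟨Diffeomorph.refl (𝓡 4) 𝕊⁴ ∞⟩ p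

/-- **The fact holds at every homotopy `4`-sphere which is diffeomorphic to `S⁴`.**
[cite: Gerig2021NoHomotopySphereInvariants, §1 (after Thm. 1.6)] -/
theorem _root_.Literature.Topology.FourManifolds.HomotopySphere.exists_taubesTubes_of_diffeomorph_sphere
    (S : Literature.Topology.FourManifolds.HomotopySphere 4)
    (hS : Nonempty (S.carrier ≃ₘ⟮𝓡 4, 𝓡 4⟯ 𝕊⁴)) (p : S.carrier) :
    ∃ (ε δ : ℝ) (sf : MForm (𝓡 4) (punctured p) ℝ 2) (Ψ₁ Ψ₂ : E4 → punctured p),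
      0 < ε ∧ Metric.closedBall (extChartAt (𝓡 4) p p) ε ⊆ (extChartAt (𝓡 4) p).target ∧
      0 < δ ∧ δ < 1 ∧ IsSmoothForm sf ∧ IsClosedForm sf ∧ IsStandardOnBall p ε sf ∧
      IsUntwistedTaubesTube p ε δ sf Ψ₁ ∧ IsUntwistedTaubesTube p ε δ sf Ψ₂ ∧
      Disjoint (Ψ₁ '' flatSolidTorus δ) (Ψ₂ '' flatSolidTorus δ) ∧
      ∀ x : punctured p, x ∉ Ψ₁ '' flatCoreCircle ∪ Ψ₂ '' flatCoreCircle →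
        ∀ v : TangentSpace (𝓡 4) x, v ≠ 0 → ∃ w : TangentSpace (𝓡 4) x, sf x ![v, w] ≠ 0 :=
  exists_taubesTubes_of_nonempty_diffeomorph_sphere hS p

/-- **"SPC4 ⇒ the fact"**: if every homotopy `4`-sphere is diffeomorphic to `S⁴`, then
`relNearSymplecticTaubesTubes_exists` holds — its body at `(Σ, p)` is, `let`s unfolded, the
conclusion of `HomotopySphere.exists_taubesTubes_of_diffeomorph_sphere`.  (The fact is printed for
EVERY homotopy `4`-sphere, Gerig 2021 Thm. 1.6; this implication isolates what it says beyond the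
standard ones.) [cite: Gerig2021NoHomotopySphereInvariants, Thm. 1.6 and §1] -/
theorem relNearSymplecticTaubesTubes_exists_of_forall_diffeomorph_sphere
    (h : ∀ S : Literature.Topology.FourManifolds.HomotopySphere 4,
      Nonempty (S.carrier ≃ₘ⟮𝓡 4, 𝓡 4⟯ 𝕊⁴)) :
    relNearSymplecticTaubesTubes_exists := by
  intro S p
  obtain ⟨ε, δ, sf, Ψ₁, Ψ₂, hε, hball, hδ, hδ1, hsm, hcl, hstd, hT₁, hT₂, hdisj, hnd⟩ :=
    S.exists_taubesTubes_of_diffeomorph_sphere (h S) p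
  exact ⟨ε, δ, sf, Ψ₁, Ψ₂, hε, hball, hδ, hδ1, hsm, hcl, hstd, hT₁, hT₂, hdisj, hnd⟩

end SphereModels

end Literature.Geometry.Symplectic

end
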